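import Summits.HodgeConjecture.CorCM.Census.PairFlipSexticFourCore
import Mathlib.Algebra.BigOperators.Group.List.Basic
import Mathlib.Tactic.Linarith
import HarnessLib

/-!
# Powers `X₀^a × X₁^b × X₂^c × X₃^d` of the four CM threefolds of a pair-flip sextic CM field: every Galois-balanced
# weight, with ANY number of copies, is a disjoint union of lifted conjugate pairs and lifted FACE 4-sets — the
# combinatorial census by induction (no `decide` on the configuration)

COR-CM (cell `pub-hodgecm2`), binder seat b25 (gen 37), count-neutral (work item W-b of B01-SIZE §4 T2); one bookkeeping
definition (`ModelBalanced`), theorems otherwise; no named fact, no geometry, no `sorry`.  Companion of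
`Census/PairFlipSexticFourCore.lean` (24-point model `Pt` of `Q = X₀ × X₁ × X₂ × X₃`, maps `act j f e` of
`ℤ/2 ≀ S₃ ⊇ (ℤ/2)³ ⋊ C₃`, CM type `phi`, generating weights `conjPair`, `face`), on the pattern (same API) of b30's
`Census/DihedralSexticPairCurvePowers.lean`, so that the frame-transfer / distribution machinery of
`CorCM/DihedralSexticPairCurvePowersTransfer.lean` + `CorCM/CMWeightDistribution.lean` applies verbatim.

MODEL OF A POWER.  A weight of `X = ⨁_j X_{κ j}` (`κ : Fin N → Fin 4`) is a CONFIGURATION: a finset `T` of an index type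
`α` with a model map `v : α → Pt` (forget the copy) — not injective.  Pohlmann's condition
`#{x ∈ T | g·v(x) ∈ Φ} = #{x ∈ T | g·v(x) ∉ Φ}` is imposed ONLY for the 24 maps `act j false e` of `(ℤ/2)³ ⋊ C₃`
(`ModelBalanced v T`): Galois conditions for BOTH closure degrees 24 and 48 (the whole stage-1 field class).

RESULTS.  `exists_defects_of_modelBalanced` — SIGN-DEFECT EQUATIONS: with `N(y) = #{x ∈ T | v x = y}`,
`D(b, i) = N(b, i, +) − N(b, i, −)`, a balanced configuration has `D(1, i) = D(2, i) = D(3, i) = −D(0, i)` at every place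
(nine independent conditions + the total count, `omega`; the forms have rank 9, so these ARE the Hodge conditions).
`exists_part_of_modelBalanced` — a non-empty balanced configuration contains a part `G`, `v` injective on `G`, `v(G)` a
generating weight (`D(0,i) > 0` ⇒ a lifted `face i true`; `< 0` ⇒ `face i false`; all zero ⇒ a lifted conjugate pair).
**`modelBalanced_induction`** — INDUCTION PRINCIPLE (a property holding for `∅` and passing from `R` to `G ∪ R` for
disjoint generating parts holds for every balanced configuration); `modelBalanced_iff_generated` (balanced ⟺ disjoint
union of lifted pairs and faces — with the defect equations the LATTICE THEOREM «Hodge lattice of ALL power products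
`= ℤ⟨12 pairs, 3 faces⟩`, rank `15 = 24 − 9`, index 1» in monoid form); `balanced_decomp_id` (one copy of each factor:
the all-degrees census of `Q`, structurally).  CONSEQUENCE (dictionary (D), (O1)–(O4) of
`Census/DihedralFourCoreLattice.lean`, formalised for this model in the transfer file): **for every abelian variety `Z`
isogenous to a product of powers of `X₀, …, X₃`, HC(`Z`) holds as soon as the face class of `X₀ × X₁ × X₂ × X₃` (ONE
Galois orbit of weights) is algebraic**; conversely it is an instance.  That face class is the rank-four face class a
PerL-type period statement (B01-SIZE §4 T2 + the non-Galois surface criterion W-a) would deliver for this field class.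
HONEST FRAMING: nothing here is a case of the Hodge conjecture; `HC_CM` is not used and NOT proved.
[cite: Pohlmann1968, Thm 1] [cite: GaoUllmo2025, Thm 3.1] [cite: Milne2020HodgeClassesAV, 1.2 (a)]

## References
* [Pohlmann1968] H. Pohlmann, Ann. of Math. 88 (1968), Thm 1.  [GaoUllmo2025] Z. Gao, E. Ullmo, J. Inst. Math. Jussieu
  25 (2025), Thm 3.1.  [Milne2020HodgeClassesAV] J. S. Milne, arXiv:2010.08857, 1.2 (a), Thm. 1.
  Oracle `work/gen_powers.py` (seat folder): rank of the 24 conditions = 9; the nine maps used are independent.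
-/

namespace Summit.HodgeConjecture.CorCM.Census.PairFlipSexticFourCorePowers

open Finset
open Summit.HodgeConjecture.CorCM.Census.PairFlipSexticFourCore (Pt act phi conjPair face gens mem_gens_iff
  mem_conjPair_iff mem_face_iff act_conj balanced₂₄ balanced_of_mem_gens)

variable {α : Type*}

section Generic

variable {β : Type*}

/-- Counting through a map injective on the part: `#{x ∈ G | Q(w x)} = #{y ∈ w(G) | Q y}`. [folklore] -/
theorem card_filter_comp_eq_card_filter_image_of_injOn [DecidableEq β] {w : α → β} {G : Finset α}
    (hinj : Set.InjOn w ↑G) (Q : β → Prop) [DecidablePred Q] :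
    (G.filter fun x => Q (w x)).card = ((G.image w).filter Q).card := by
  rw [Finset.filter_image, Finset.card_image_of_injOn]
  exact fun x hx y hy h => hinj (Finset.mem_of_mem_filter _ hx) (Finset.mem_of_mem_filter _ hy) h

/-- Fibrewise counting. [folklore] -/
theorem card_filter_comp_eq_sum_fiber [Fintype β] [DecidableEq β] (w : α → β) (T : Finset α) (Q : β → Prop)
    [DecidablePred Q] : (T.filter fun x => Q (w x)).card = ∑ y ∈ univ.filter Q, (T.filter fun x => w x = y).card := by
  rw [Finset.card_eq_sum_card_fiberwise (f := w) (t := univ.filter Q)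
    (fun x hx => Finset.mem_filter.2 ⟨Finset.mem_univ _, (Finset.mem_filter.1 hx).2⟩)]
  refine Finset.sum_congr rfl fun y hy => ?_
  have hQy : Q y := (Finset.mem_filter.1 hy).2
  congr 1
  ext x
  simp only [Finset.mem_filter]
  constructor
  · rintro ⟨⟨hx, -⟩, hxy⟩; exact ⟨hx, hxy⟩
  · rintro ⟨hx, hxy⟩; exact ⟨⟨hx, hxy ▸ hQy⟩, hxy⟩

/-- The same with the in-set enumerated by a duplicate-free list. [folklore] -/
theorem card_filter_comp_eq_list_sum_fiber [Fintype β] [DecidableEq β] (w : α → β) (T : Finset α) (Q : β → Prop)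
    [DecidablePred Q] (l : List β) (hl : l.Nodup) (hQ : univ.filter Q = l.toFinset) :
    (T.filter fun x => Q (w x)).card = (l.map fun y => (T.filter fun x => w x = y).card).sum := by
  rw [card_filter_comp_eq_sum_fiber, hQ, List.sum_toFinset _ hl]

/-- A finset of model points all of which are hit by `T` is the injective image of a part of `T`. [folklore] -/
theorem exists_injOn_part_of_forall_exists [DecidableEq α] [DecidableEq β] {w : α → β} {T : Finset α}
    (W : Finset β) (hW : ∀ y ∈ W, ∃ x ∈ T, w x = y) : ∃ G ⊆ T, Set.InjOn w ↑G ∧ G.image w = W := by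
  classical
  by_cases hWe : W = ∅
  · subst hWe
    exact ⟨∅, Finset.empty_subset _, fun x hx => absurd hx (by simp), Finset.image_empty _⟩
  obtain ⟨y₀, hy₀⟩ := Finset.nonempty_iff_ne_empty.2 hWe
  obtain ⟨x₀, -, -⟩ := hW y₀ hy₀
  haveI : Nonempty α := ⟨x₀⟩
  choose! pick hpickT hpickv using hW
  refine ⟨W.image pick, fun x hx => ?_, fun x hx x' hx' hxx' => ?_, ?_⟩
  · obtain ⟨y, hy, rfl⟩ := Finset.mem_image.1 hx
    exact hpickT y hy
  · obtain ⟨y, hy, rfl⟩ := Finset.mem_image.1 (Finset.mem_coe.1 hx)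
    obtain ⟨y', hy', rfl⟩ := Finset.mem_image.1 (Finset.mem_coe.1 hx')
    rw [hpickv y hy, hpickv y' hy'] at hxx'
    rw [hxx']
  · rw [Finset.image_image]
    conv_rhs => rw [← Finset.image_id (s := W)]
    exact Finset.image_congr fun y hy => by simpa using hpickv y (Finset.mem_coe.1 hy)

/-- A model point hit by `T` means a positive fibre count. [folklore] -/
theorem exists_mem_of_filter_card_pos [DecidableEq β] {w : α → β} {T : Finset α} {y : β}
    (h : 0 < (T.filter fun x => w x = y).card) : ∃ x ∈ T, w x = y := by
  obtain ⟨x, hx⟩ := Finset.card_pos.1 h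
  exact ⟨x, (Finset.mem_filter.1 hx).1, (Finset.mem_filter.1 hx).2⟩

end Generic

/-! ### Balanced configurations -/

/-- **Pohlmann's condition for a configuration** `(T, v)` (a weight of a power read in the 24-point model, `v` the
copy-forgetting model map), for the 24 maps `act j false e` of `(ℤ/2)³ ⋊ C₃`. [cite: GaoUllmo2025, Thm 3.1 eq. (3.2)] -/
def ModelBalanced (v : α → Pt) (T : Finset α) : Prop :=
  ∀ (j : ZMod 3) (e : Bool × Bool × Bool),
    (T.filter fun x => act j false e (v x) ∈ phi).card = (T.filter fun x => act j false e (v x) ∉ phi).card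

variable (v : α → Pt)

/-- Balanced ⟺ twice the `Φ`-count is the size, for every `g`. [cite: GaoUllmo2025, Thm 3.1 eq. (3.2)] -/
theorem modelBalanced_iff_two_mul (T : Finset α) : ModelBalanced v T ↔ ∀ (j : ZMod 3) (e : Bool × Bool × Bool),
    2 * (T.filter fun x => act j false e (v x) ∈ phi).card = T.card := by
  refine forall_congr' fun j => forall_congr' fun e => ?_
  have h := Finset.card_filter_add_card_filter_not (s := T) (fun x => act j false e (v x) ∈ phi)
  omega

/-- The empty configuration is balanced. [folklore] -/
theorem modelBalanced_empty : ModelBalanced v (∅ : Finset α) := fun _ _ => by simp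

variable {v}

/-- **Removing a balanced part keeps the balance.** [folklore] -/
theorem ModelBalanced.sdiff [DecidableEq α] {T G : Finset α} (hT : ModelBalanced v T) (hG : ModelBalanced v G)
    (hGT : G ⊆ T) : ModelBalanced v (T \ G) := by
  intro j e
  have key : ∀ (Q : α → Prop) [DecidablePred Q],
      ((T \ G).filter Q).card = (T.filter Q).card - (G.filter Q).card := by
    intro Q _
    rw [← Finset.card_sdiff_of_subset (Finset.filter_subset_filter Q hGT)]
    congr 1
    ext x
    simp only [Finset.mem_filter, Finset.mem_sdiff]
    tauto
  rw [key, key, hT j e, hG j e]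

/-- The union of two disjoint balanced configurations is balanced. [folklore] -/
theorem ModelBalanced.union [DecidableEq α] {G R : Finset α} (hG : ModelBalanced v G) (hR : ModelBalanced v R)
    (hGR : Disjoint G R) : ModelBalanced v (G ∪ R) := by
  intro j e
  rw [Finset.filter_union, Finset.filter_union,
    Finset.card_union_of_disjoint (Finset.disjoint_filter_filter hGR),
    Finset.card_union_of_disjoint (Finset.disjoint_filter_filter hGR), hG j e, hR j e]

/-- A part on which `v` is injective with balanced model image is balanced. [cite: GaoUllmo2025, Thm 3.1] -/
theorem modelBalanced_of_injOn_of_balanced₂₄ {G : Finset α} (hinj : Set.InjOn v ↑G)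
    (hbal : balanced₂₄ (G.image v) = true) : ModelBalanced v G := by
  intro j e
  rw [balanced₂₄, decide_eq_true_eq] at hbal
  rw [card_filter_comp_eq_card_filter_image_of_injOn hinj (fun y => act j false e y ∈ phi),
    card_filter_comp_eq_card_filter_image_of_injOn hinj (fun y => act j false e y ∉ phi)]
  exact hbal (j, e)

/-- **Generating parts are balanced** (the census file's `balanced_of_mem_gens`). [cite: Pohlmann1968, Thm 1] -/
theorem modelBalanced_of_image_mem_gens {G : Finset α} (hinj : Set.InjOn v ↑G) (hg : G.image v ∈ gens) :
    ModelBalanced v G :=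
  modelBalanced_of_injOn_of_balanced₂₄ hinj (balanced_of_mem_gens hg).2

/-! ### Counting fibrewise -/

variable (v)

/-- The total count: `|T| = Σ_y #{x ∈ T | v x = y}` over the 24 model points. [folklore] -/
theorem card_eq_list_sum (T : Finset α) :
    T.card = ([((0 : Fin 4), (0 : ZMod 3), true), (0, 0, false), (0, 1, true), (0, 1, false), (0, 2, true), (0, 2, false),
      (1, 0, true), (1, 0, false), (1, 1, true), (1, 1, false), (1, 2, true), (1, 2, false),
      (2, 0, true), (2, 0, false), (2, 1, true), (2, 1, false), (2, 2, true), (2, 2, false),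
      (3, 0, true), (3, 0, false), (3, 1, true), (3, 1, false), (3, 2, true), (3, 2, false)].map
        fun y : Pt => (T.filter fun x => v x = y).card).sum := by
  rw [← card_filter_comp_eq_list_sum_fiber v T (fun _ => True) _ (by decide) (by decide)]
  simp

/-! ### The sign-defect equations -/

variable {v}

set_option maxHeartbeats 4000000 in
/-- **THE SIGN-DEFECT EQUATIONS of a balanced configuration.**  With `N(y) = #{x ∈ T | v x = y}` and
`D(b, i) = N(b, i, +) − N(b, i, −)`: at every place `i`, `D(1, i) = D(2, i) = D(3, i) = −D(0, i)`.  (From nine of the 24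
conditions — the maps `(j, e)` with `j ∈ ℤ/3` and `e ∈ {(−,−,−), (−,−,+), (−,+,−)}`, whose forms are independent —
and the total count; these nine equations are equivalent to all 24, the forms having rank 9.)
[cite: GaoUllmo2025, Thm 3.1] [cite: Pohlmann1968, Thm 1] -/
theorem exists_defects_of_modelBalanced {T : Finset α} (hT : ModelBalanced v T) :
    ∀ i : ZMod 3, ∀ b : Fin 4, b ≠ 0 →
      ((T.filter fun x => v x = (b, i, true)).card : ℤ) - (T.filter fun x => v x = (b, i, false)).card =
        -(((T.filter fun x => v x = (0, i, true)).card : ℤ) - (T.filter fun x => v x = (0, i, false)).card) := by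
  have hb := (modelBalanced_iff_two_mul v T).1 hT
  have e1 := hb 0 (false, false, false)
  have e2 := hb 1 (false, false, false)
  have e3 := hb 2 (false, false, false)
  have e4 := hb 0 (false, false, true)
  have e5 := hb 0 (false, true, false)
  have e6 := hb 1 (false, false, true)
  have e7 := hb 1 (false, true, false)
  have e8 := hb 2 (false, false, true)
  have e9 := hb 2 (false, true, false)
  rw [card_filter_comp_eq_list_sum_fiber v T (fun y => act 0 false (false, false, false) y ∈ phi)
    [(0, 0, true), (0, 1, true), (0, 2, true), (1, 0, false), (1, 1, true), (1, 2, true), (2, 0, true), (2, 1, false),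
      (2, 2, true), (3, 0, true), (3, 1, true), (3, 2, false)] (by decide) (by decide)] at e1
  rw [card_filter_comp_eq_list_sum_fiber v T (fun y => act 1 false (false, false, false) y ∈ phi)
    [(0, 0, true), (0, 1, true), (0, 2, true), (1, 0, true), (1, 1, true), (1, 2, false), (2, 0, false), (2, 1, true),
      (2, 2, true), (3, 0, true), (3, 1, false), (3, 2, true)] (by decide) (by decide)] at e2
  rw [card_filter_comp_eq_list_sum_fiber v T (fun y => act 2 false (false, false, false) y ∈ phi)
    [(0, 0, true), (0, 1, true), (0, 2, true), (1, 0, true), (1, 1, false), (1, 2, true), (2, 0, true), (2, 1, true),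
      (2, 2, false), (3, 0, false), (3, 1, true), (3, 2, true)] (by decide) (by decide)] at e3
  rw [card_filter_comp_eq_list_sum_fiber v T (fun y => act 0 false (false, false, true) y ∈ phi)
    [(0, 0, true), (0, 1, true), (0, 2, false), (1, 0, false), (1, 1, true), (1, 2, false), (2, 0, true), (2, 1, false),
      (2, 2, false), (3, 0, true), (3, 1, true), (3, 2, true)] (by decide) (by decide)] at e4
  rw [card_filter_comp_eq_list_sum_fiber v T (fun y => act 0 false (false, true, false) y ∈ phi)
    [(0, 0, true), (0, 1, false), (0, 2, true), (1, 0, false), (1, 1, false), (1, 2, true), (2, 0, true), (2, 1, true),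
      (2, 2, true), (3, 0, true), (3, 1, false), (3, 2, false)] (by decide) (by decide)] at e5
  rw [card_filter_comp_eq_list_sum_fiber v T (fun y => act 1 false (false, false, true) y ∈ phi)
    [(0, 0, true), (0, 1, false), (0, 2, true), (1, 0, true), (1, 1, false), (1, 2, false), (2, 0, false), (2, 1, false),
      (2, 2, true), (3, 0, true), (3, 1, true), (3, 2, true)] (by decide) (by decide)] at e6
  rw [card_filter_comp_eq_list_sum_fiber v T (fun y => act 1 false (false, true, false) y ∈ phi)
    [(0, 0, false), (0, 1, true), (0, 2, true), (1, 0, false), (1, 1, true), (1, 2, false), (2, 0, true), (2, 1, true),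
      (2, 2, true), (3, 0, false), (3, 1, false), (3, 2, true)] (by decide) (by decide)] at e7
  rw [card_filter_comp_eq_list_sum_fiber v T (fun y => act 2 false (false, false, true) y ∈ phi)
    [(0, 0, false), (0, 1, true), (0, 2, true), (1, 0, false), (1, 1, false), (1, 2, true), (2, 0, false), (2, 1, true),
      (2, 2, false), (3, 0, true), (3, 1, true), (3, 2, true)] (by decide) (by decide)] at e8
  rw [card_filter_comp_eq_list_sum_fiber v T (fun y => act 2 false (false, true, false) y ∈ phi)
    [(0, 0, true), (0, 1, true), (0, 2, false), (1, 0, true), (1, 1, false), (1, 2, false), (2, 0, true), (2, 1, true),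
      (2, 2, true), (3, 0, false), (3, 1, true), (3, 2, false)] (by decide) (by decide)] at e9
  have e0 := card_eq_list_sum v T
  simp only [List.map_cons, List.map_nil, List.sum_cons, List.sum_nil] at e0 e1 e2 e3 e4 e5 e6 e7 e8 e9
  intro i b hb
  fin_cases i <;> fin_cases b <;> first | exact absurd rfl hb | (push_cast; omega)

/-! ### Extraction of a generating part -/

/-- **EXTRACTION.**  A non-empty balanced configuration contains a part `G` on which the model map is injective and
whose image is a generating weight (`conjPair` or `face i s`): by the sign-defect equations, if `D(0, i) > 0` then
`(0, i, +)` and the three `(b, i, −)` are hit (a lifted `face i true`), if `D(0, i) < 0` then `(0, i, −)` and the three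
`(b, i, +)` are hit (a lifted `face i false`), and if all defects vanish the conjugate of any hit point is hit (a lifted
conjugate pair). [cite: Milne2020HodgeClassesAV, 1.2 (a) and Thm. 1] [cite: Pohlmann1968, Thm 1] -/
theorem exists_part_of_modelBalanced [DecidableEq α] {T : Finset α} (hT : ModelBalanced v T) (hne : T.Nonempty) :
    ∃ G ⊆ T, G.Nonempty ∧ Set.InjOn v ↑G ∧ G.image v ∈ gens := by
  have hD := exists_defects_of_modelBalanced hT
  -- an opaque name for the 24 counts
  obtain ⟨N, hN⟩ : ∃ N : Pt → ℕ, ∀ y, (T.filter fun x => v x = y).card = N y := ⟨_, fun _ => rfl⟩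
  simp only [hN] at hD
  have hit : ∀ y, 0 < N y → ∃ x ∈ T, v x = y := fun y hy => exists_mem_of_filter_card_pos (w := v) (by rw [hN]; exact hy)
  -- a generating weight all of whose points are hit gives the part
  have conclude : ∀ W ∈ gens, W.Nonempty → (∀ y ∈ W, 0 < N y) →
      ∃ G ⊆ T, G.Nonempty ∧ Set.InjOn v ↑G ∧ G.image v ∈ gens := by
    intro W hW hWne hWhit
    obtain ⟨G, hGT, hinj, hGW⟩ := exists_injOn_part_of_forall_exists W fun y hy => hit y (hWhit y hy)
    refine ⟨G, hGT, ?_, hinj, hGW ▸ hW⟩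
    obtain ⟨y, hy⟩ := hWne
    rw [← hGW] at hy
    obtain ⟨x, hx, -⟩ := Finset.mem_image.1 hy
    exact ⟨x, hx⟩
  have hgensF : ∀ i s, face i s ∈ gens := fun i s => (mem_gens_iff _).2 (Or.inr ⟨i, s, rfl⟩)
  have hgens2 : ∀ y, conjPair y ∈ gens := fun y => (mem_gens_iff _).2 (Or.inl ⟨y, rfl⟩)
  have hneF : ∀ i s, (face i s).Nonempty := fun i s => ⟨(0, i, s), (mem_face_iff i s _).2 (Or.inl rfl)⟩
  have hne2 : ∀ y, (conjPair y).Nonempty := fun y => ⟨y, (mem_conjPair_iff _ _).2 (Or.inl rfl)⟩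
  -- `face i s`: all points hit when `D(0, i)` has the sign of `s`
  have face_hit : ∀ (i : ZMod 3) (s : Bool), 0 < N (0, i, s) → (∀ b : Fin 4, b ≠ 0 → 0 < N (b, i, !s)) →
      ∀ y ∈ face i s, 0 < N y := by
    intro i s h0 hb y hy
    rcases (mem_face_iff i s y).1 hy with rfl | rfl | rfl | rfl
    · exact h0
    · exact hb 1 (by decide)
    · exact hb 2 (by decide)
    · exact hb 3 (by decide)
  -- case analysis on the signs of the three defects `D(0, i)`
  by_cases hpos : ∃ i : ZMod 3, (N (0, i, false) : ℤ) < N (0, i, true)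
  · obtain ⟨i, hi⟩ := hpos
    refine conclude _ (hgensF i true) (hneF i true) (face_hit i true (by omega) fun b hb => ?_)
    have := hD i b hb
    simp only [Bool.not_true]
    omega
  by_cases hneg : ∃ i : ZMod 3, (N (0, i, true) : ℤ) < N (0, i, false)
  · obtain ⟨i, hi⟩ := hneg
    refine conclude _ (hgensF i false) (hneF i false) (face_hit i false (by omega) fun b hb => ?_)
    have := hD i b hb
    simp only [Bool.not_false]
    omega
  -- all defects vanish: the conjugate of a hit point is hit
  push Not at hpos hneg
  have hzero : ∀ (b : Fin 4) (i : ZMod 3), N (b, i, true) = N (b, i, false) := by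
    intro b i
    have h0 : (N (0, i, true) : ℤ) = N (0, i, false) := le_antisymm (hpos i) (hneg i)
    by_cases hb : b = 0
    · subst hb; exact_mod_cast h0
    · have := hD i b hb
      omega
  obtain ⟨x, hx⟩ := hne
  have hNx : 0 < N (v x) := by
    rw [← hN]
    exact Finset.card_pos.2 ⟨x, Finset.mem_filter.2 ⟨hx, rfl⟩⟩
  refine conclude _ (hgens2 (v x)) (hne2 (v x)) fun y hy => ?_
  rcases (mem_conjPair_iff _ _).1 hy with rfl | rfl
  · exact hNx
  · revert hNx
    rcases v x with ⟨b, i, s⟩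
    rw [act_conj]
    intro hNx
    cases s
    · simp only [Bool.not_false]
      rw [hzero b i]; exact hNx
    · simp only [Bool.not_true]
      rw [← hzero b i]; exact hNx

/-! ### The induction principle -/

/-- **INDUCTION PRINCIPLE FOR BALANCED CONFIGURATIONS (any number of copies).**  Let `motive` hold for the empty
configuration and pass from `R` to `G ∪ R` whenever `G` is disjoint from `R`, the model map is injective on `G` and
`v(G)` is a generating weight of the 24-point model (a conjugate pair or a face).  Then `motive` holds for every balanced
configuration: by extraction, a non-empty balanced `T` is `G ⊔ (T ∖ G)` with `G` a generating part, and `T ∖ G` is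
balanced and smaller. [cite: Milne2020HodgeClassesAV, 1.2 (a) and Thm. 1] [cite: GaoUllmo2025, Thm 3.1] -/
theorem modelBalanced_induction [DecidableEq α] {motive : Finset α → Prop} (h0 : motive ∅)
    (hstep : ∀ G R : Finset α, Disjoint G R → Set.InjOn v ↑G → G.image v ∈ gens → motive R → motive (G ∪ R))
    {T : Finset α} (hT : ModelBalanced v T) : motive T := by
  induction T using Finset.strongInduction with
  | H T ih =>
    by_cases hTe : T = ∅
    · subst hTe; exact h0
    obtain ⟨G, hGT, hGne, hinj, hG⟩ := exists_part_of_modelBalanced hT (Finset.nonempty_iff_ne_empty.2 hTe)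
    have hR : ModelBalanced v (T \ G) := hT.sdiff (modelBalanced_of_image_mem_gens hinj hG) hGT
    have hlt : T \ G ⊂ T := Finset.sdiff_ssubset hGT hGne
    have h := hstep G (T \ G) Finset.disjoint_sdiff hinj hG (ih _ hlt hR)
    rwa [Finset.union_sdiff_of_subset hGT] at h

/-- A member of a list of finsets is contained in their union. [folklore] -/
theorem subset_foldr_union_of_mem {R : Finset α} [DecidableEq α] :
    ∀ {parts : List (Finset α)}, R ∈ parts → R ⊆ parts.foldr (· ∪ ·) ∅
  | [], h => absurd h (by simp)
  | P :: ps, h => by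
    simp only [List.foldr_cons]
    rcases List.mem_cons.1 h with rfl | h
    · exact Finset.subset_union_left
    · exact (subset_foldr_union_of_mem h).trans Finset.subset_union_right

/-- A finset disjoint from every member of a list is disjoint from their union. [folklore] -/
theorem disjoint_foldr_union {G : Finset α} [DecidableEq α] :
    ∀ {parts : List (Finset α)}, (∀ R ∈ parts, Disjoint G R) → Disjoint G (parts.foldr (· ∪ ·) ∅)
  | [], _ => by simp
  | P :: ps, h => by
    simp only [List.foldr_cons, Finset.disjoint_union_right]
    exact ⟨h P (by simp), disjoint_foldr_union fun R hR => h R (List.mem_cons_of_mem _ hR)⟩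

/-- **Balanced configurations are exactly the disjoint unions of generating parts** (⟸ of the induction principle:
every configuration built from `∅` by adjoining disjoint generating parts is balanced). [cite: Pohlmann1968, Thm 1] -/
theorem modelBalanced_iff_generated [DecidableEq α] (T : Finset α) : ModelBalanced v T ↔
    ∃ parts : List (Finset α), (∀ G ∈ parts, Set.InjOn v ↑G ∧ G.image v ∈ gens) ∧
      parts.Pairwise Disjoint ∧ parts.foldr (· ∪ ·) ∅ = T := by
  constructor
  · intro hT
    refine modelBalanced_induction (motive := fun T => ∃ parts : List (Finset α),
      (∀ G ∈ parts, Set.InjOn v ↑G ∧ G.image v ∈ gens) ∧ parts.Pairwise Disjoint ∧ parts.foldr (· ∪ ·) ∅ = T)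
      ⟨[], by simp, List.Pairwise.nil, rfl⟩ ?_ hT
    rintro G R hGR hinj hG ⟨parts, hparts, hpw, rfl⟩
    refine ⟨G :: parts, ?_, ?_, rfl⟩
    · intro G' hG'
      rcases List.mem_cons.1 hG' with rfl | h
      · exact ⟨hinj, hG⟩
      · exact hparts G' h
    · exact List.Pairwise.cons (fun R' hR' => Finset.disjoint_of_subset_right (subset_foldr_union_of_mem hR') hGR) hpw
  · rintro ⟨parts, hparts, hpw, rfl⟩
    induction parts with
    | nil => exact modelBalanced_empty v
    | cons G ps ih =>
      simp only [List.foldr_cons]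
      have hG := hparts G (by simp)
      exact (modelBalanced_of_image_mem_gens hG.1 hG.2).union
        (ih (fun G' hG' => hparts G' (List.mem_cons_of_mem _ hG')) (List.Pairwise.of_cons hpw))
        (disjoint_foldr_union (List.pairwise_cons.1 hpw).1)

/-- **ONE copy of each factor** (`v = id`): every Galois-balanced weight of `Q = X₀ × X₁ × X₂ × X₃` (balanced for the 24
maps, a fortiori for the 48) is a disjoint union of conjugate pairs and faces — the all-degrees census of `Q`, proved
structurally. [cite: Pohlmann1968, Thm 1] [cite: GaoUllmo2025, Thm 3.1] -/
theorem balanced_decomp_id (S : Finset Pt) (hS : balanced₂₄ S = true) :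
    ∃ parts : List (Finset Pt), (∀ G ∈ parts, G ∈ gens) ∧ parts.Pairwise Disjoint ∧ parts.foldr (· ∪ ·) ∅ = S := by
  have hM : ModelBalanced (id : Pt → Pt) S := by
    rw [balanced₂₄, decide_eq_true_eq] at hS
    intro j e
    exact hS (j, e)
  obtain ⟨parts, hparts, hpw, hS'⟩ := (modelBalanced_iff_generated (v := id) S).1 hM
  refine ⟨parts, fun G hG => ?_, hpw, hS'⟩
  have h := (hparts G hG).2
  rwa [Finset.image_id] at h

end Summit.HodgeConjecture.CorCM.Census.PairFlipSexticFourCorePowers
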